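import Literature.AlgebraicTopology.Homotopy.SuspensionNaturality
import Literature.AlgebraicTopology.Homotopy.HopfFibration
import Literature.AlgebraicTopology.SingularHomology.HurewiczTheoremProofs
import Literature.AlgebraicTopology.SingularHomology.SphereHomology
import Literature.AlgebraicTopology.FundamentalGroup.SphereSimplyConnected
import Literature.AlgebraicTopology.Homotopy.HomotopyGroupsGeneralPosition
import Mathlib.Analysis.SpecialFunctions.Trigonometric.Basic
import HarnessLib

/-!
# `2·Ση = 0`: every element of `π₄(S³)` has order at most two, and `|π₄(S³)| ≤ 2`

Topic `Literature/AlgebraicTopology/Homotopy`. H. Freudenthal, *Über die Klassen der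
Sphärenabbildungen I*, Compositio Math. 5 (1937), 299–314 (`π₄(S³)` has order two, generated by the
suspension of the Hopf map); A. Hatcher, *Algebraic Topology* (2002), §4.2 Cor. 4.24–4.25 and the
discussion following them ("`πₙ₊₁(Sⁿ)` is `ℤ₂` for `n ≥ 3`, generated by the suspension of the Hopf
map"), Example 4.45. This file PROVES the upper bound by the classical conjugation symmetry of the
Hopf map, entirely inside the tree's cubical homotopy groups:

* `conjS2`, `conjS3`, `conjBoth` — the conjugation `c(ξ, t) = (ξ̄, t)` of `S²`, its suspension
  `Φ = S(c)` on `S³`, and `G(z, w) = (z̄, w̄)` on `S³`; `hopf_conjBoth : η ∘ G = c ∘ η`;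
* `rotHomotopy : id ≃ G` (rotation by `πt` in the `(x₁, x₃)`-plane, stationary at
  `x₀ = (1,0,0,0)`) and `pencilHomotopy : Φ ≃ R` (the pencil of reflections `s_{v_t}`,
  `v_t = (0, cos(πt/2), 0, sin(πt/2))`, stationary at `(0,0,1,0)`), `R` the equatorial reflection;
* `conjS2_trivial` — `c_* = 1` on `π₃(S², η x₀)` (`η_*` onto, `HopfFibration.lean`; `G ≃ id`);
* **`suspension_sq_eq_one`, `sq_eq_one`** — `E z = E(c_* z) = Φ_*(E z) = R_*(E z) = (E z)⁻¹`
  (`SuspensionNaturality.lean`, `SuspensionReflection.lean`, based-homotopy invariance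
  `BasedMaps.lean`), so `(E z)² = 1`, and `E` is onto `π₄(S³)` (Freudenthal);
* `isCyclic_pi_three_sphere_three` (Hurewicz + `H₃(S³) ≅ ℤ`), `isCyclic_pi_four_sphere_three`,
  **`card_pi_four_sphere_three_le'`** — `|π₄(S³, y)| ≤ 2` at every base point.

The lower bound (`Ση ≠ 0`, via `Sq²` on `ΣℂP²`) is not in this file. Everything is proved; no named
facts.

## References

* H. Freudenthal, *Über die Klassen der Sphärenabbildungen I. Große Dimensionen*, Compositio
  Math. 5 (1937), 299–314. [Freudenthal1937]
* A. Hatcher, *Algebraic Topology*, CUP (2002), §4.1 p. 342, §4.2 Cor. 4.24–4.25 (p. 360–361),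
  Example 4.45, Thm. 4.32. [HatcherAT2002]
-/

noncomputable section

open Set Function Metric Topology unitInterval Real Complex ComplexConjugate
open scoped Topology
open Literature.AlgebraicTopology.SingularHomology.SphereComplement
open Literature.AlgebraicTopology.SingularHomology

namespace Literature.AlgebraicTopology.Homotopy

namespace PiFourSphereThree

open Hemi HopfFibration

/-- Local notation: `𝔼 n` is `EuclideanSpace ℝ (Fin n)`. -/
local notation "𝔼 " n:arg => EuclideanSpace ℝ (Fin n)

/-- Local notation: `𝕊 n` is the unit sphere of `EuclideanSpace ℝ (Fin (n + 1))`. -/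
local notation "𝕊 " n:arg => (Metric.sphere (0 : EuclideanSpace ℝ (Fin (n + 1))) 1)


/-! ### Points of `S³` and `S²` from coordinates -/

/-- `‖v‖² = v₀² + v₁² + v₂² + v₃²` on `ℝ⁴`. [folklore] -/
theorem norm_sq_four (v : 𝔼 4) : ‖v‖ ^ 2 = v 0 ^ 2 + v 1 ^ 2 + v 2 ^ 2 + v 3 ^ 2 := by
  rw [EuclideanSpace.real_norm_sq_eq]
  simp [Fin.sum_univ_succ]
  ring

/-- `‖v‖² = v₀² + v₁² + v₂²` on `ℝ³`. [folklore] -/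
theorem norm_sq_three (v : 𝔼 3) : ‖v‖ ^ 2 = v 0 ^ 2 + v 1 ^ 2 + v 2 ^ 2 := by
  rw [EuclideanSpace.real_norm_sq_eq]
  simp [Fin.sum_univ_succ]
  ring

/-- The coordinates of a point of `S³` have squares summing to `1`. [folklore] -/
theorem sum_sq_four (x : 𝕊 3) :
    (x : 𝔼 4) 0 ^ 2 + (x : 𝔼 4) 1 ^ 2 + (x : 𝔼 4) 2 ^ 2 + (x : 𝔼 4) 3 ^ 2 = 1 := by
  have h : ‖(x : 𝔼 4)‖ = 1 := by simp
  rw [← norm_sq_four, h, one_pow]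

/-- The coordinates of a point of `S²` have squares summing to `1`. [folklore] -/
theorem sum_sq_three (y : 𝕊 2) : (y : 𝔼 3) 0 ^ 2 + (y : 𝔼 3) 1 ^ 2 + (y : 𝔼 3) 2 ^ 2 = 1 := by
  have h : ‖(y : 𝔼 3)‖ = 1 := by simp
  rw [← norm_sq_three, h, one_pow]

/-- The point `(a, b, c, d)` of `S³`. [folklore] -/
def mkS3 (a b c d : ℝ) (h : a ^ 2 + b ^ 2 + c ^ 2 + d ^ 2 = 1) : 𝕊 3 :=
  ⟨WithLp.toLp 2 ![a, b, c, d], by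
    have h2 : ‖(WithLp.toLp 2 ![a, b, c, d] : 𝔼 4)‖ ^ 2 = 1 := by
      rw [norm_sq_four]; simpa using h
    rw [mem_sphere_zero_iff_norm]
    nlinarith [norm_nonneg (WithLp.toLp 2 ![a, b, c, d] : 𝔼 4)]⟩

/-- Coordinate `0` of `mkS3`. [folklore] -/
@[simp] theorem mkS3_apply0 (a b c d : ℝ) (h) : ((mkS3 a b c d h : 𝕊 3) : 𝔼 4) 0 = a := rfl
/-- Coordinate `1` of `mkS3`. [folklore] -/
@[simp] theorem mkS3_apply1 (a b c d : ℝ) (h) : ((mkS3 a b c d h : 𝕊 3) : 𝔼 4) 1 = b := rfl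
/-- Coordinate `2` of `mkS3`. [folklore] -/
@[simp] theorem mkS3_apply2 (a b c d : ℝ) (h) : ((mkS3 a b c d h : 𝕊 3) : 𝔼 4) 2 = c := rfl
/-- Coordinate `3` of `mkS3`. [folklore] -/
@[simp] theorem mkS3_apply3 (a b c d : ℝ) (h) : ((mkS3 a b c d h : 𝕊 3) : 𝔼 4) 3 = d := rfl

/-- The point `(a, b, c)` of `S²`. [folklore] -/
def mkS2 (a b c : ℝ) (h : a ^ 2 + b ^ 2 + c ^ 2 = 1) : 𝕊 2 :=
  ⟨WithLp.toLp 2 ![a, b, c], by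
    have h2 : ‖(WithLp.toLp 2 ![a, b, c] : 𝔼 3)‖ ^ 2 = 1 := by
      rw [norm_sq_three]; simpa using h
    rw [mem_sphere_zero_iff_norm]
    nlinarith [norm_nonneg (WithLp.toLp 2 ![a, b, c] : 𝔼 3)]⟩

/-- Coordinate `0` of `mkS2`. [folklore] -/
@[simp] theorem mkS2_apply0 (a b c : ℝ) (h) : ((mkS2 a b c h : 𝕊 2) : 𝔼 3) 0 = a := rfl
/-- Coordinate `1` of `mkS2`. [folklore] -/
@[simp] theorem mkS2_apply1 (a b c : ℝ) (h) : ((mkS2 a b c h : 𝕊 2) : 𝔼 3) 1 = b := rfl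
/-- Coordinate `2` of `mkS2`. [folklore] -/
@[simp] theorem mkS2_apply2 (a b c : ℝ) (h) : ((mkS2 a b c h : 𝕊 2) : 𝔼 3) 2 = c := rfl

/-- Points of `S³` with equal coordinates are equal. [folklore] -/
theorem ext_S3 {x y : 𝕊 3} (h0 : (x : 𝔼 4) 0 = (y : 𝔼 4) 0) (h1 : (x : 𝔼 4) 1 = (y : 𝔼 4) 1)
    (h2 : (x : 𝔼 4) 2 = (y : 𝔼 4) 2) (h3 : (x : 𝔼 4) 3 = (y : 𝔼 4) 3) : x = y := by
  apply Subtype.ext; ext i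
  fin_cases i
  · exact h0
  · exact h1
  · exact h2
  · exact h3

/-- Points of `S²` with equal coordinates are equal. [folklore] -/
theorem ext_S2 {x y : 𝕊 2} (h0 : (x : 𝔼 3) 0 = (y : 𝔼 3) 0) (h1 : (x : 𝔼 3) 1 = (y : 𝔼 3) 1)
    (h2 : (x : 𝔼 3) 2 = (y : 𝔼 3) 2) : x = y := by
  apply Subtype.ext; ext i
  fin_cases i
  · exact h0
  · exact h1
  · exact h2

/-- The coordinates of `S³` are continuous. [folklore] -/
theorem continuous_coord4 (i : Fin 4) : Continuous fun x : 𝕊 3 => (x : 𝔼 4) i :=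
  (PiLp.continuous_apply 2 _ i).comp continuous_subtype_val

/-- The coordinates of `S²` are continuous. [folklore] -/
theorem continuous_coord3 (i : Fin 3) : Continuous fun y : 𝕊 2 => (y : 𝔼 3) i :=
  (PiLp.continuous_apply 2 _ i).comp continuous_subtype_val

/-- A map into `S³` with continuous coordinates is continuous. [folklore] -/
theorem continuous_mkS3 {X : Type*} [TopologicalSpace X] {a b c d : X → ℝ} (ha : Continuous a)
    (hb : Continuous b) (hc : Continuous c) (hd : Continuous d) (h : ∀ x, a x ^ 2 + b x ^ 2 + c x ^ 2 + d x ^ 2 = 1) :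
    Continuous fun x => mkS3 (a x) (b x) (c x) (d x) (h x) := by
  unfold mkS3
  refine Continuous.subtype_mk ((PiLp.continuous_toLp 2 _).comp (continuous_pi fun i => ?_)) _
  fin_cases i
  · exact ha
  · exact hb
  · exact hc
  · exact hd

/-- A map into `S²` with continuous coordinates is continuous. [folklore] -/
theorem continuous_mkS2 {X : Type*} [TopologicalSpace X] {a b c : X → ℝ} (ha : Continuous a)
    (hb : Continuous b) (hc : Continuous c) (h : ∀ x, a x ^ 2 + b x ^ 2 + c x ^ 2 = 1) :
    Continuous fun x => mkS2 (a x) (b x) (c x) (h x) := by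
  unfold mkS2
  refine Continuous.subtype_mk ((PiLp.continuous_toLp 2 _).comp (continuous_pi fun i => ?_)) _
  fin_cases i
  · exact ha
  · exact hb
  · exact hc

/-! ### The three sign maps -/

/-- **The conjugation `c` of `S² ⊂ ℂ × ℝ`**, `(ξ, t) ↦ (ξ̄, t)`, i.e. `(y₀, y₁, y₂) ↦ (y₀, -y₁, y₂)`. [folklore] -/
def conjS2 : C(𝕊 2, 𝕊 2) where
  toFun y := mkS2 ((y : 𝔼 3) 0) (-(y : 𝔼 3) 1) ((y : 𝔼 3) 2) (by rw [neg_sq]; exact sum_sq_three y)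
  continuous_toFun := continuous_mkS2 (b := fun y : 𝕊 2 => -(y : 𝔼 3) 1) (continuous_coord3 0)
    (continuous_coord3 1).neg (continuous_coord3 2) fun y => by rw [neg_sq]; exact sum_sq_three y

/-- **The suspension `Φ = S(c)` of the conjugation**, `(x₀, x₁, x₂, x₃) ↦ (x₀, -x₁, x₂, x₃)` on `S³` (last coordinate = height untouched). [folklore] -/
def conjS3 : C(𝕊 3, 𝕊 3) where
  toFun x := mkS3 ((x : 𝔼 4) 0) (-(x : 𝔼 4) 1) ((x : 𝔼 4) 2) ((x : 𝔼 4) 3) (by rw [neg_sq]; exact sum_sq_four x)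
  continuous_toFun := continuous_mkS3 (b := fun x : 𝕊 3 => -(x : 𝔼 4) 1) (continuous_coord4 0)
    (continuous_coord4 1).neg (continuous_coord4 2) (continuous_coord4 3) fun x => by
      rw [neg_sq]; exact sum_sq_four x

/-- **Complex conjugation of both coordinates of `S³ ⊂ ℂ²`**, `G : (z, w) ↦ (z̄, w̄)`, i.e. `(x₀, x₁, x₂, x₃) ↦ (x₀, -x₁, x₂, -x₃)`. [folklore] -/
def conjBoth : C(𝕊 3, 𝕊 3) where
  toFun x := mkS3 ((x : 𝔼 4) 0) (-(x : 𝔼 4) 1) ((x : 𝔼 4) 2) (-(x : 𝔼 4) 3)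
    (by rw [neg_sq, neg_sq]; exact sum_sq_four x)
  continuous_toFun := continuous_mkS3 (b := fun x : 𝕊 3 => -(x : 𝔼 4) 1) (d := fun x : 𝕊 3 => -(x : 𝔼 4) 3)
    (continuous_coord4 0) (continuous_coord4 1).neg (continuous_coord4 2) (continuous_coord4 3).neg fun x => by
      rw [neg_sq, neg_sq]; exact sum_sq_four x

/-- Coordinate `0` of `c`. [folklore] -/
@[simp] theorem conjS2_apply0 (y : 𝕊 2) : ((conjS2 y : 𝕊 2) : 𝔼 3) 0 = (y : 𝔼 3) 0 := rfl
/-- Coordinate `1` of `c`. [folklore] -/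
@[simp] theorem conjS2_apply1 (y : 𝕊 2) : ((conjS2 y : 𝕊 2) : 𝔼 3) 1 = -(y : 𝔼 3) 1 := rfl
/-- Coordinate `2` of `c`. [folklore] -/
@[simp] theorem conjS2_apply2 (y : 𝕊 2) : ((conjS2 y : 𝕊 2) : 𝔼 3) 2 = (y : 𝔼 3) 2 := rfl
/-- Coordinate `0` of `Φ`. [folklore] -/
@[simp] theorem conjS3_apply0 (x : 𝕊 3) : ((conjS3 x : 𝕊 3) : 𝔼 4) 0 = (x : 𝔼 4) 0 := rfl
/-- Coordinate `1` of `Φ`. [folklore] -/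
@[simp] theorem conjS3_apply1 (x : 𝕊 3) : ((conjS3 x : 𝕊 3) : 𝔼 4) 1 = -(x : 𝔼 4) 1 := rfl
/-- Coordinate `2` of `Φ`. [folklore] -/
@[simp] theorem conjS3_apply2 (x : 𝕊 3) : ((conjS3 x : 𝕊 3) : 𝔼 4) 2 = (x : 𝔼 4) 2 := rfl
/-- Coordinate `3` of `Φ`. [folklore] -/
@[simp] theorem conjS3_apply3 (x : 𝕊 3) : ((conjS3 x : 𝕊 3) : 𝔼 4) 3 = (x : 𝔼 4) 3 := rfl
/-- Coordinate `0` of `G`. [folklore] -/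
@[simp] theorem conjBoth_apply0 (x : 𝕊 3) : ((conjBoth x : 𝕊 3) : 𝔼 4) 0 = (x : 𝔼 4) 0 := rfl
/-- Coordinate `1` of `G`. [folklore] -/
@[simp] theorem conjBoth_apply1 (x : 𝕊 3) : ((conjBoth x : 𝕊 3) : 𝔼 4) 1 = -(x : 𝔼 4) 1 := rfl
/-- Coordinate `2` of `G`. [folklore] -/
@[simp] theorem conjBoth_apply2 (x : 𝕊 3) : ((conjBoth x : 𝕊 3) : 𝔼 4) 2 = (x : 𝔼 4) 2 := rfl
/-- Coordinate `3` of `G`. [folklore] -/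
@[simp] theorem conjBoth_apply3 (x : 𝕊 3) : ((conjBoth x : 𝕊 3) : 𝔼 4) 3 = -(x : 𝔼 4) 3 := rfl

/-- The height of `FreudenthalSuspension.lean` is the last coordinate. [folklore] -/
theorem hgt_eq (y : 𝕊 3) : hgt y = (y : 𝔼 4) 3 := rfl

/-- `Φ` preserves the height. [folklore] -/
theorem hgt_conjS3 (y : 𝕊 3) : hgt (conjS3 y) = hgt y := rfl

/-- The coordinates of the equatorial embedding `(y₀, y₁, y₂) ↦ (y₀, y₁, y₂, 0)`. [folklore] -/
theorem equator_coords (x' : 𝕊 2) :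
    ((equator x' : 𝕊 3) : 𝔼 4) 0 = (x' : 𝔼 3) 0 ∧ ((equator x' : 𝕊 3) : 𝔼 4) 1 = (x' : 𝔼 3) 1 ∧
      ((equator x' : 𝕊 3) : 𝔼 4) 2 = (x' : 𝔼 3) 2 ∧ ((equator x' : 𝕊 3) : 𝔼 4) 3 = 0 := by
  refine ⟨?_, ?_, ?_, ?_⟩
  · exact snocE_apply_castSucc (x' : 𝔼 3) 0 0
  · exact snocE_apply_castSucc (x' : 𝔼 3) 0 1
  · exact snocE_apply_castSucc (x' : 𝔼 3) 0 2
  · exact snocE_apply_last (x' : 𝔼 3) 0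

/-- **`Φ` is the suspension of `c`**: `Φ (y, 0) = (c y, 0)`. [folklore] -/
theorem conjS3_equator (x' : 𝕊 2) : conjS3 (equator x') = equator (conjS2 x') := by
  obtain ⟨h0, h1, h2, h3⟩ := equator_coords x'
  obtain ⟨k0, k1, k2, k3⟩ := equator_coords (conjS2 x')
  apply ext_S3
  · rw [conjS3_apply0, h0, k0, conjS2_apply0]
  · rw [conjS3_apply1, h1, k1, conjS2_apply1]
  · rw [conjS3_apply2, h2, k2, conjS2_apply2]
  · rw [conjS3_apply3, h3, k3]

/-- The coordinates of the equatorial reflection `R : (x₀, x₁, x₂, x₃) ↦ (x₀, x₁, x₂, -x₃)`. [folklore] -/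
theorem refl_coords (y : 𝕊 3) :
    ((refl y : 𝕊 3) : 𝔼 4) 0 = (y : 𝔼 4) 0 ∧ ((refl y : 𝕊 3) : 𝔼 4) 1 = (y : 𝔼 4) 1 ∧
      ((refl y : 𝕊 3) : 𝔼 4) 2 = (y : 𝔼 4) 2 ∧ ((refl y : 𝕊 3) : 𝔼 4) 3 = -(y : 𝔼 4) 3 := by
  refine ⟨?_, ?_, ?_, ?_⟩
  · exact snocE_apply_castSucc (proj y) (-hgt y) 0
  · exact snocE_apply_castSucc (proj y) (-hgt y) 1
  · exact snocE_apply_castSucc (proj y) (-hgt y) 2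
  · exact snocE_apply_last (proj y) (-hgt y)

/-! ### The rotation homotopy `id ≃ G` -/

/-- Rotations of the `(x₁, x₃)`-plane preserve `S³`. [folklore] -/
theorem rot_norm (t : I) (x : 𝕊 3) :
    (x : 𝔼 4) 0 ^ 2 + (Real.cos (π * t) * (x : 𝔼 4) 1 - Real.sin (π * t) * (x : 𝔼 4) 3) ^ 2 +
      (x : 𝔼 4) 2 ^ 2 + (Real.sin (π * t) * (x : 𝔼 4) 1 + Real.cos (π * t) * (x : 𝔼 4) 3) ^ 2 = 1 := by
  have h := sum_sq_four x
  have hcs := Real.cos_sq_add_sin_sq (π * t)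
  linear_combination h + ((x : 𝔼 4) 1 ^ 2 + (x : 𝔼 4) 3 ^ 2) * hcs

/-- The rotation by the angle `πt` in the `(x₁, x₃)`-plane of `ℝ⁴ = ℂ²` (a path in `SO(4)` from the identity to `G`). [folklore] -/
def rotFun (p : I × (𝕊 3)) : 𝕊 3 :=
  mkS3 ((p.2 : 𝔼 4) 0) (Real.cos (π * p.1) * (p.2 : 𝔼 4) 1 - Real.sin (π * p.1) * (p.2 : 𝔼 4) 3)
    ((p.2 : 𝔼 4) 2) (Real.sin (π * p.1) * (p.2 : 𝔼 4) 1 + Real.cos (π * p.1) * (p.2 : 𝔼 4) 3)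
    (rot_norm p.1 p.2)

/-- The rotation family is continuous. [folklore] -/
theorem continuous_rotFun : Continuous rotFun := by
  have hc : ∀ j : Fin 4, Continuous fun p : I × (𝕊 3) => (p.2 : 𝔼 4) j := fun j =>
    (continuous_coord4 j).comp continuous_snd
  have ht : Continuous fun p : I × (𝕊 3) => π * (p.1 : ℝ) :=
    continuous_const.mul (continuous_subtype_val.comp continuous_fst)
  exact continuous_mkS3 (hc 0)
    (((Real.continuous_cos.comp ht).mul (hc 1)).sub ((Real.continuous_sin.comp ht).mul (hc 3))) (hc 2)
    (((Real.continuous_sin.comp ht).mul (hc 1)).add ((Real.continuous_cos.comp ht).mul (hc 3))) _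

/-- **The homotopy `id ≃ G` through rotations**, stationary at `x₀ = (1, 0, 0, 0)`. [folklore] -/
def rotHomotopy : (ContinuousMap.id (𝕊 3)).Homotopy conjBoth where
  toFun := rotFun
  continuous_toFun := continuous_rotFun
  map_zero_left x := by
    apply ext_S3 <;> simp [rotFun]
  map_one_left x := by
    apply ext_S3 <;> simp [rotFun]

/-! ### The pencil of reflections `Φ ≃ R` -/

/-- Reflections in hyperplanes preserve `S³` (the pencil through `e₁`, `e₃`). [folklore] -/
theorem pencil_norm (t : I) (x : 𝕊 3) :
    (x : 𝔼 4) 0 ^ 2 +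
      ((x : 𝔼 4) 1 - 2 * Real.cos (π / 2 * t) *
        (Real.cos (π / 2 * t) * (x : 𝔼 4) 1 + Real.sin (π / 2 * t) * (x : 𝔼 4) 3)) ^ 2 +
      (x : 𝔼 4) 2 ^ 2 +
      ((x : 𝔼 4) 3 - 2 * Real.sin (π / 2 * t) *
        (Real.cos (π / 2 * t) * (x : 𝔼 4) 1 + Real.sin (π / 2 * t) * (x : 𝔼 4) 3)) ^ 2 = 1 := by
  have h := sum_sq_four x
  have hcs := Real.cos_sq_add_sin_sq (π / 2 * t)
  linear_combination h +
    4 * (Real.cos (π / 2 * t) * (x : 𝔼 4) 1 + Real.sin (π / 2 * t) * (x : 𝔼 4) 3) ^ 2 * hcs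

/-- The reflection of `S³` in the hyperplane orthogonal to `v_t = (0, cos(πt/2), 0, sin(πt/2))`: a path of reflections from `Φ = s_{e₁}` to `R = s_{e₃}`, all fixing `e₀` and `e₂`. [folklore] -/
def pencilFun (p : I × (𝕊 3)) : 𝕊 3 :=
  mkS3 ((p.2 : 𝔼 4) 0)
    ((p.2 : 𝔼 4) 1 - 2 * Real.cos (π / 2 * p.1) *
      (Real.cos (π / 2 * p.1) * (p.2 : 𝔼 4) 1 + Real.sin (π / 2 * p.1) * (p.2 : 𝔼 4) 3))
    ((p.2 : 𝔼 4) 2)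
    ((p.2 : 𝔼 4) 3 - 2 * Real.sin (π / 2 * p.1) *
      (Real.cos (π / 2 * p.1) * (p.2 : 𝔼 4) 1 + Real.sin (π / 2 * p.1) * (p.2 : 𝔼 4) 3))
    (pencil_norm p.1 p.2)

/-- The pencil of reflections is continuous. [folklore] -/
theorem continuous_pencilFun : Continuous pencilFun := by
  have hc : ∀ j : Fin 4, Continuous fun p : I × (𝕊 3) => (p.2 : 𝔼 4) j := fun j =>
    (continuous_coord4 j).comp continuous_snd
  have ht : Continuous fun p : I × (𝕊 3) => π / 2 * (p.1 : ℝ) :=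
    continuous_const.mul (continuous_subtype_val.comp continuous_fst)
  have hq : Continuous fun p : I × (𝕊 3) =>
      Real.cos (π / 2 * (p.1 : ℝ)) * (p.2 : 𝔼 4) 1 + Real.sin (π / 2 * (p.1 : ℝ)) * (p.2 : 𝔼 4) 3 :=
    ((Real.continuous_cos.comp ht).mul (hc 1)).add ((Real.continuous_sin.comp ht).mul (hc 3))
  exact continuous_mkS3 (hc 0) ((hc 1).sub ((continuous_const.mul (Real.continuous_cos.comp ht)).mul hq))
    (hc 2) ((hc 3).sub ((continuous_const.mul (Real.continuous_sin.comp ht)).mul hq)) _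

/-- **The homotopy `Φ ≃ R` through reflections**, stationary at `(0, 0, 1, 0)`. [folklore] -/
def pencilHomotopy : conjS3.Homotopy (⟨refl, continuous_refl⟩ : C(𝕊 3, 𝕊 3)) where
  toFun := pencilFun
  continuous_toFun := continuous_pencilFun
  map_zero_left x := by
    apply ext_S3
    · simp [pencilFun]
    · simp [pencilFun]; ring
    · simp [pencilFun]
    · simp [pencilFun]
  map_one_left x := by
    obtain ⟨h0, h1, h2, h3⟩ := refl_coords x
    apply ext_S3
    · simp only [pencilFun, mkS3_apply0]; exact h0.symm
    · simp [pencilFun]; exact h1.symm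
    · simp only [pencilFun, mkS3_apply2]; exact h2.symm
    · simp [pencilFun]; rw [h3]; ring

/-! ### The Hopf map intertwines `G` and `c` -/

/-- Coordinate `0` of the Hopf map: `Re(2 z w̄)`. [folklore] -/
theorem hopfVec_apply0 (x : 𝔼 4) : hopfVec x 0 = (2 * zC x * conj (wC x)).re := by simp [hopfVec]
/-- Coordinate `1` of the Hopf map: `Im(2 z w̄)`. [folklore] -/
theorem hopfVec_apply1 (x : 𝔼 4) : hopfVec x 1 = (2 * zC x * conj (wC x)).im := by simp [hopfVec]
/-- Coordinate `2` of the Hopf map: `|z|² - |w|²`. [folklore] -/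
theorem hopfVec_apply2 (x : 𝔼 4) : hopfVec x 2 = normSq (zC x) - normSq (wC x) := by simp [hopfVec]

/-- **The conjugation symmetry of the Hopf map: `η ∘ G = c ∘ η`** (`η(z̄, w̄) = (conj(2 z w̄), |z|² - |w|²)`). [cite: HatcherAT2002, Example 4.45] -/
theorem hopf_conjBoth (x : 𝕊 3) : hopf (conjBoth x) = conjS2 (hopf x) := by
  apply ext_S2
  · show hopfVec (conjBoth x : 𝕊 3) 0 = hopfVec x 0
    rw [hopfVec_apply0, hopfVec_apply0]
    simp [zC, wC, Complex.mul_re, Complex.mul_im]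
  · show hopfVec (conjBoth x : 𝕊 3) 1 = -hopfVec x 1
    rw [hopfVec_apply1, hopfVec_apply1]
    simp [zC, wC, Complex.mul_re, Complex.mul_im]
    ring
  · show hopfVec (conjBoth x : 𝕊 3) 2 = hopfVec x 2
    rw [hopfVec_apply2, hopfVec_apply2]
    simp [zC, wC, normSq_apply]

/-! ### Base points -/

/-- The base point `x₀ = (1, 0, 0, 0)` of `S³` (`z = 1`, `w = 0`). [folklore] -/
def x₀ : 𝕊 3 := mkS3 1 0 0 0 (by norm_num)

/-- `η x₀ = (0, 0, 1)`, coordinate `0`. [folklore] -/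
theorem hopf_x₀_apply0 : ((hopf x₀ : 𝕊 2) : 𝔼 3) 0 = 0 := by
  show hopfVec (x₀ : 𝕊 3) 0 = 0
  rw [hopfVec_apply0]; simp [zC, wC, x₀, Complex.mul_re]
/-- `η x₀ = (0, 0, 1)`, coordinate `1`. [folklore] -/
theorem hopf_x₀_apply1 : ((hopf x₀ : 𝕊 2) : 𝔼 3) 1 = 0 := by
  show hopfVec (x₀ : 𝕊 3) 1 = 0
  rw [hopfVec_apply1]; simp [zC, wC, x₀, Complex.mul_im]
/-- `η x₀ = (0, 0, 1)`, coordinate `2`. [folklore] -/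
theorem hopf_x₀_apply2 : ((hopf x₀ : 𝕊 2) : 𝔼 3) 2 = 1 := by
  show hopfVec (x₀ : 𝕊 3) 2 = 1
  rw [hopfVec_apply2]; simp [zC, wC, x₀, normSq_apply]

/-- `c` fixes the base point `η x₀`. [folklore] -/
theorem conjS2_hopf_x₀ : hopf x₀ = conjS2 (hopf x₀) :=
  ext_S2 rfl (by rw [conjS2_apply1, hopf_x₀_apply1, neg_zero]) rfl

/-- `G` fixes `x₀`. [folklore] -/
theorem conjBoth_x₀ : x₀ = conjBoth x₀ :=
  ext_S3 rfl (by show (0 : ℝ) = -0; rw [neg_zero]) rfl (by show (0 : ℝ) = -0; rw [neg_zero])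

/-- The coordinates of the suspended base point `ŷ = (y, 0)`. [folklore] -/
theorem liftBase_coords (y : 𝕊 2) :
    ((Freudenthal.liftBase 2 y : 𝕊 3) : 𝔼 4) 0 = (y : 𝔼 3) 0 ∧ ((Freudenthal.liftBase 2 y : 𝕊 3) : 𝔼 4) 1 = (y : 𝔼 3) 1 ∧
      ((Freudenthal.liftBase 2 y : 𝕊 3) : 𝔼 4) 2 = (y : 𝔼 3) 2 ∧ ((Freudenthal.liftBase 2 y : 𝕊 3) : 𝔼 4) 3 = 0 :=
  equator_coords y

/-- `Φ` fixes the suspended base point `(η x₀, 0) = (0, 0, 1, 0)`. [folklore] -/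
theorem conjS3_liftBase : Freudenthal.liftBase 2 (hopf x₀) = conjS3 (Freudenthal.liftBase 2 (hopf x₀)) := by
  obtain ⟨h0, h1, h2, h3⟩ := liftBase_coords (hopf x₀)
  exact ext_S3 rfl (by rw [conjS3_apply1, h1, hopf_x₀_apply1, neg_zero]) rfl rfl

/-- `rotHomotopy` on points. [folklore] -/
theorem rotHomotopy_apply (q : I × (𝕊 3)) : rotHomotopy q = rotFun q := rfl
/-- `pencilHomotopy` on points. [folklore] -/
theorem pencilHomotopy_apply (q : I × (𝕊 3)) : pencilHomotopy q = pencilFun q := rfl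

/-- The rotation homotopy is stationary at `x₀`. [folklore] -/
theorem rot_x₀ (t : I) : rotHomotopy (t, x₀) = x₀ := by
  rw [rotHomotopy_apply]
  apply ext_S3 <;> simp [rotFun, x₀]

/-- The pencil homotopy is stationary at `(0, 0, 1, 0)`. [folklore] -/
theorem pencil_liftBase (t : I) :
    pencilHomotopy (t, Freudenthal.liftBase 2 (hopf x₀)) = Freudenthal.liftBase 2 (hopf x₀) := by
  obtain ⟨h0, h1, h2, h3⟩ := liftBase_coords (hopf x₀)
  rw [hopf_x₀_apply1] at h1
  rw [pencilHomotopy_apply]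
  apply ext_S3
  · simp [pencilFun]
  · simp [pencilFun, h1, h3]
  · simp [pencilFun]
  · simp [pencilFun, h1, h3]

/-! ### `c_* = 1` on `π₃(S², η x₀)` -/

/-- **`c_* = 1` on `π₃(S², η x₀)`**: every class is `η_* g` (`η_*` is onto, Hopf fibration), and `c_* η_* g = (c ∘ η)_* g = (η ∘ G)_* g = η_* G_* g = η_* g` since `G ≃ id` rel `x₀`. [cite: HatcherAT2002, Example 4.45, §4.1 p. 342] -/
theorem conjS2_trivial (z : HomotopyGroup (Fin 3) (𝕊 2) (hopf x₀)) :
    homotopyGroupMapOfEq conjS2 conjS2_hopf_x₀ z = z := by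
  obtain ⟨g, rfl⟩ := (bijective_homotopyGroupMap_hopf (N := Fin 3) (by simp) x₀).2 z
  have hG : homotopyGroupMapOfEq conjBoth conjBoth_x₀ g = g :=
    (homotopyGroupMapOfEq_eq_of_homotopy rotHomotopy (rfl : x₀ = ContinuousMap.id _ x₀) conjBoth_x₀ rot_x₀ g).symm.trans
      (homotopyGroupMapOfEq_id rfl g)
  have hcomp : conjS2.comp hopf = hopf.comp conjBoth := ContinuousMap.ext fun x => (hopf_conjBoth x).symm
  calc homotopyGroupMapOfEq conjS2 conjS2_hopf_x₀ (homotopyGroupMap hopf x₀ g)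
      = homotopyGroupMapOfEq conjS2 conjS2_hopf_x₀ (homotopyGroupMapOfEq hopf rfl g) := by
        rw [homotopyGroupMapOfEq_rfl]
    _ = homotopyGroupMapOfEq (conjS2.comp hopf) (conjS2_hopf_x₀.trans (congrArg conjS2 rfl)) g :=
        homotopyGroupMapOfEq_comp _ _ _ _ g
    _ = homotopyGroupMapOfEq (hopf.comp conjBoth) ((rfl : hopf x₀ = hopf x₀).trans (congrArg hopf conjBoth_x₀)) g :=
        homotopyGroupMapOfEq_congr hcomp _ _ g
    _ = homotopyGroupMapOfEq hopf rfl (homotopyGroupMapOfEq conjBoth conjBoth_x₀ g) :=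
        (homotopyGroupMapOfEq_comp hopf rfl conjBoth conjBoth_x₀ g).symm
    _ = homotopyGroupMap hopf x₀ g := by rw [hG, homotopyGroupMapOfEq_rfl]

/-! ### Every suspension has order `≤ 2` in `π₄(S³)` -/

/-- **`(E z)² = 1` for every `z ∈ π₃(S², η x₀)`**: `E z = E (c_* z) = Φ_* (E z) = R_* (E z) = (E z)⁻¹` (naturality of `E`, `Φ ≃ R` rel base point, and the reflection formula). This is the classical `2 Ση = 0` (H. Freudenthal, Compositio Math. 5 (1937); Hatcher 2002, §4.2, discussion after Cor. 4.25: `π₄(S³) = ℤ₂` generated by `Ση`). [cite: HatcherAT2002, §4.2 Cor. 4.24 (p. 360)] -/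
theorem suspension_sq_eq_one (z : π_ 3 (𝕊 2) (hopf x₀)) :
    Freudenthal.suspension 2 2 (hopf x₀) z * Freudenthal.suspension 2 2 (hopf x₀) z = 1 := by
  have hR : Freudenthal.liftBase 2 (hopf x₀) = Freudenthal.reflMap (Freudenthal.liftBase 2 (hopf x₀)) :=
    (Freudenthal.refl_loBase (Freudenthal.equatorHomeo 2 (hopf x₀))).symm
  have h1 : homotopyGroupMapOfEq Freudenthal.reflMap hR (Freudenthal.suspension 2 2 (hopf x₀) z) =
      (Freudenthal.suspension 2 2 (hopf x₀) z)⁻¹ :=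
    Freudenthal.homotopyGroupMapOfEq_refl_suspension 2 (hopf x₀) z
  have h2 : homotopyGroupMapOfEq conjS3 conjS3_liftBase (Freudenthal.suspension 2 2 (hopf x₀) z) =
      Freudenthal.suspension 2 2 (hopf x₀) (homotopyGroupMapOfEq conjS2 conjS2_hopf_x₀ z) :=
    Freudenthal.suspension_natural 2 conjS3 hgt_conjS3 conjS2 conjS3_equator (hopf x₀) conjS2_hopf_x₀
      conjS3_liftBase z
  have h3 : homotopyGroupMapOfEq conjS3 conjS3_liftBase (Freudenthal.suspension 2 2 (hopf x₀) z) =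
      homotopyGroupMapOfEq Freudenthal.reflMap hR (Freudenthal.suspension 2 2 (hopf x₀) z) :=
    homotopyGroupMapOfEq_eq_of_homotopy pencilHomotopy conjS3_liftBase hR pencil_liftBase _
  rw [conjS2_trivial] at h2
  have h4 : Freudenthal.suspension 2 2 (hopf x₀) z = (Freudenthal.suspension 2 2 (hopf x₀) z)⁻¹ :=
    h2.symm.trans (h3.trans h1)
  calc Freudenthal.suspension 2 2 (hopf x₀) z * Freudenthal.suspension 2 2 (hopf x₀) z
      = Freudenthal.suspension 2 2 (hopf x₀) z * (Freudenthal.suspension 2 2 (hopf x₀) z)⁻¹ :=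
        congrArg (Freudenthal.suspension 2 2 (hopf x₀) z * ·) h4
    _ = 1 := mul_inv_cancel _

/-- **Every element of `π₄(S³)` has order at most `2`** (`E : π₃(S²) → π₄(S³)` is onto by Freudenthal). [cite: HatcherAT2002, §4.2 Cor. 4.24 (p. 360)] -/
theorem sq_eq_one (u : π_ 4 (𝕊 3) (Freudenthal.liftBase 2 (hopf x₀))) : u * u = 1 := by
  obtain ⟨z, rfl⟩ := Freudenthal.suspension_surjective (n := 2) (m := 2) (by norm_num) (hopf x₀) u
  exact suspension_sq_eq_one z

/-! ### `π₃(S³)` and `π₄(S³)` are cyclic; `|π₄(S³)| ≤ 2` -/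

/-- **`π₃(S³)` is cyclic** (Hurewicz: `π₃(S³) ≅ H₃(S³; ℤ) ≅ ℤ`). [cite: HatcherAT2002, Thm. 4.32, Cor. 4.25] -/
theorem isCyclic_pi_three_sphere_three (x : 𝕊 3) : IsCyclic (π_ 3 (𝕊 3) x) := by
  haveI : SimplyConnectedSpace (𝕊 3) :=
    Literature.AlgebraicTopology.FundamentalGroup.simplyConnectedSpace_euclideanSphere 3 (by norm_num)
  have hconn : ∀ k : ℕ, 2 ≤ k → k < 3 → ∀ y : 𝕊 3, Subsingleton (π_ k (𝕊 3) y) := fun k _ hk y =>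
    subsingleton_homotopyGroup_sphere (by rw [finrank_euclideanSpace, Fintype.card_fin]; omega) y
  obtain ⟨e⟩ := hurewicz_iso_of_collapseDevice (𝕊 3) 3 (by norm_num) hconn x
  obtain ⟨e'⟩ := nonempty_singularHomology_sphere_iso_holds ℤ ℤ (n := 3) (by norm_num)
  let f : Multiplicative ℤ ≃* π_ 3 (𝕊 3) x :=
    ((AddEquiv.toMultiplicative (AddEquiv.ulift.symm.trans e'.toLinearEquiv.toAddEquiv.symm)).trans e.symm)
  exact isCyclic_of_surjective f.toMonoidHom f.surjective

/-- **`π₄(S³)` is cyclic** (onto image of `π₃(S³)` under `E ∘ η_*`). [cite: HatcherAT2002, §4.2 Cor. 4.24, Example 4.45] -/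
theorem isCyclic_pi_four_sphere_three : IsCyclic (π_ 4 (𝕊 3) (Freudenthal.liftBase 2 (hopf x₀))) := by
  haveI := isCyclic_pi_three_sphere_three x₀
  have hs : Surjective ((Freudenthal.suspension 2 2 (hopf x₀)).comp (homotopyGroupMapHom (N := Fin 3) hopf x₀)) :=
    (Freudenthal.suspension_surjective (n := 2) (m := 2) (by norm_num) (hopf x₀)).comp
      (bijective_homotopyGroupMap_hopf (N := Fin 3) (by simp) x₀).2
  exact isCyclic_of_surjective _ hs

/-- **`π₄(S³)` has at most two elements** (cyclic of exponent `2`), at the base point `(0, 0, 1, 0)`. [cite: HatcherAT2002, §4.2 Cor. 4.24 (p. 360)] -/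
theorem card_pi_four_sphere_three_le : Nat.card (π_ 4 (𝕊 3) (Freudenthal.liftBase 2 (hopf x₀))) ≤ 2 := by
  obtain ⟨g, hg⟩ := (isCyclic_pi_four_sphere_three).exists_generator
  rw [← orderOf_eq_card_of_forall_mem_zpowers hg]
  have h2 : orderOf g ∣ 2 := orderOf_dvd_of_pow_eq_one (by rw [pow_two]; exact sq_eq_one g)
  exact Nat.le_of_dvd (by norm_num) h2

/-- **`π₄(S³, y)` has at most two elements at every base point** (spheres are homogeneous). [cite: HatcherAT2002, §4.2 Cor. 4.24 (p. 360)] -/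
theorem card_pi_four_sphere_three_le' (y : 𝕊 3) : Nat.card (π_ 4 (𝕊 3) y) ≤ 2 := by
  obtain ⟨e⟩ := Freudenthal.nonempty_mulEquiv_of_basepoints (k := 4) (i := 3) y (Freudenthal.liftBase 2 (hopf x₀))
  rw [Nat.card_congr e.toEquiv]
  exact card_pi_four_sphere_three_le


end PiFourSphereThree

end Literature.AlgebraicTopology.Homotopy

end
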